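import Summits.RiemannHypothesis.RiemannHypothesis.Theorems.JensenPolynomialsLogBandXiDerivRightHalfPlane
import HarnessLib

/-!
# Route JensenLogBand, EDGE crux `XiDerivEdgeReal` (stmt-RiemannHypothesis-19912) — registered stub
# `stub_edgeRight` of the BC3 line `edge-region-split`, LANDED for all shifts (RH-FREE)

The registered stub (planner-rh-jensen-theory-g9-0, 2026-08-27T01:06:54Z): zeros of `ξ₁⁽ⁿ⁾` in the
edge annulus `chainRadius n ≤ ‖z‖ ≤ 64 (n/log n)²` with `Re z ≥ 0` are real, `n ≥ n₁`. It holds with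
`n₁ = 0` and without any radius condition because NO derivative `ξ₁⁽ⁿ⁾` vanishes on the closed right
half-plane (Gauss–Lucas in genus zero, tree `LogBand.iteratedDeriv_xiSq_ne_zero_of_re_nonneg`,
p479837; independently `Literature…iteratedDeriv_xiSq_ne_zero_of_re_nonneg`, prover g7 p478060).
WHAT THIS IS NOT: the EDGE crux is its other stub `stub_edgeLeft` (Re z < 0, two coalescing
saddles) — untouched here; nothing here bears on zeros of `ζ` off the line or the truth of RH.
(prover-rh-jensen-eng-2-g5-0, 2026-08-27.)
-/

set_option linter.dupNamespace false

namespace Summit.RiemannHypothesis.RiemannHypothesis.Theorems.JensenLogBand.XiDerivEdgeReal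

/-- **Registered stub `stub_edgeRight` of crux `XiDerivEdgeReal` (line edge-region-split), verbatim
signature, witness `n₁ = 0`.** RH-FREE. -/
theorem stub_edgeRight : ∃ n₁ : ℕ, ∀ n : ℕ, n₁ ≤ n → ∀ z : ℂ,
    iteratedDeriv n Literature.NumberTheory.LFunctions.xiSq z = 0 →
      Summit.RiemannHypothesis.RiemannHypothesis.Theorems.JensenPolynomials.chainRadius n ≤ ‖z‖ →
        ‖z‖ ≤ 64 * ((n : ℝ) / Real.log n) ^ 2 → 0 ≤ z.re → z.im = 0 :=
  Summit.RiemannHypothesis.RiemannHypothesis.Theorems.JensenPolynomials.LogBand.stub_edgeRight_allShifts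

end Summit.RiemannHypothesis.RiemannHypothesis.Theorems.JensenLogBand.XiDerivEdgeReal
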